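import Summits.HodgeConjecture.HodgeConjecture.Theorems.MarkmanPartnerTransportIsometrySpannedThirdKappaClasses
import Literature.AlgebraicGeometry.Hyperkaehler.MarkmanRationalHodgeIsometries
import Literature.AlgebraicGeometry.HodgeTheory.ComplexGysinCorrespondence
import Literature.AlgebraicGeometry.HodgeTheory.SupportedHodgeClassesAlgebraic
import Literature.AlgebraicGeometry.HodgeTheory.GysinKernelProofs
import Literature.AlgebraicGeometry.HodgeTheory.MotivatedClassesAssembly
import Literature.AlgebraicTopology.SingularHomology.GysinMapSupportProofs
import HarnessLib

/-!
# Route MarkmanPartnerTransport · support #3 `IsometrySpannedThird` — the kappa classes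
# `κ_g = pr_{1*}(Q_X ∪ Z_g)` from the inverse Beauville–Bogomolov class `Q_X = q⁻¹ ∈ H⁴(X × X)`

Cell `hodge-nonav`, planner p1 g35 (memo `HOME/memos/ROUTE-P1AH.md` §2.8, sketch `HOME/p1/route/Sketch_P1AH_QX_g35.lean`
sha16 2b655ebe7f9b22a6), prover seat `hodge-nonav-20241-p1` (g10), target W-QX1. SUPPORT FILE
(`--supports stmt-HodgeConjecture-19651 --as helper`; CONDITIONAL results, nothing here closes an item).

The tree theorem `isometrySpannedThird_of_kappaClasses` (file `…IsometrySpannedThirdKappaClasses`, 19652-p1 g6)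
reduces the item `IsometrySpannedThird` of route `MarkmanPartnerTransport` (stmt-HodgeConjecture-19651), at EVERY
Picard rank and without a K3 partner, to the algebraicity of the explicit classes
`κ_g := Σᵢⱼ (G⁻¹)ᵢⱼ · φ⁻¹eᵢ ∪ g(φ⁻¹eⱼ) ∈ H⁴(X(ℂ); ℂ)` for every bijective rational Hodge `q`-isometry `g` of
`H²(X)` (`G` the Gram matrix of `q = k3HilbertForm 2`). This file:

* `qInvClass φ` — the class `Q_X := Σᵢⱼ (G⁻¹)ᵢⱼ · pr₁^*(φ⁻¹eᵢ) ∪ pr₂^*(φ⁻¹eⱼ) ∈ H⁴((X ⊗ X)(ℂ); ℂ)` (REAL definition: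
  the inverse Beauville–Bogomolov tensor `q⁻¹ ∈ H² ⊗ H² ⊂ H⁴(X × X)`);
* `QInvAlgebraic` — the statement "for every marked smooth projective `K3^{[2]}`-type `X`, `Q_X` is algebraic on
  `X ⊗ X` in codimension `2`" (a `Prop`, consumed below as a HYPOTHESIS; its derivation from the Lefschetz standard
  conjecture for `K3^{[2]}`-type — Charles–Markman 2013 — is the separate target W-QX2);
* `kappaClasses_of_qInvAlgebraic` — **`QInvAlgebraic` + Markman's theorem (marked form,
  `Markman2024_rationalHodgeIsometry_algebraic_marked`: `g = [Z_g]_* = pr_{1*}(pr₂^*(–) ∪ Z_g)` with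
  `Z_g ∈ A⁴(X ⊗ X)`) + multiplicativity of algebraic classes (`Voisin2003_cupProduct_algebraicClasses`) ⟹ every
  `κ_g` is algebraic**: by the projection formula `complexGysin_cup` and associativity/bilinearity of the cup
  product, `κ_g = pr_{1*}(Q_X ∪ Z_g)`, and Gysin push-forwards of algebraic classes are algebraic
  (`complexGysin_mem_supportedClasses` with `gysinMap_restrictCompl_eq_zero_of_field`). No composition of
  correspondences, no triple products;
* `isometrySpannedThird_of_qInvAlgebraic` — the one-line composition with `isometrySpannedThird_of_kappaClasses`:
  `IsometrySpannedThird` BY NAME modulo {Verbitsky–Guan, O'Grady, Voisin cup, Markman 2024 (marked)} and the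
  hypothesis `QInvAlgebraic`.

HONEST SCOPE: conditional; `QInvAlgebraic` is an undischarged hypothesis here (W-QX2); nothing in this file says
HC or HC for a new variety is proved; rung F-H1 not moved.

## References

* [Markman2024] E. Markman, Rational Hodge isometries of hyper-Kähler varieties of K3^[n] type are algebraic,
  Compos. Math. 160 (2024), Thm. 1.1.
* [VoisinHodgeII2003] C. Voisin, Hodge Theory and Complex Algebraic Geometry II (2003), proof of Thm. 10.17 (10.7),
  §9.2.4 Prop. 9.20.
* [FultonYoungTableaux1997] W. Fulton, Young Tableaux (1997), App. B §B.1 (5)–(6).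
* [OGrady2008NumericalK3Square] K. O'Grady, Irreducible symplectic 4-folds numerically equivalent to (K3)^[2],
  Commun. Contemp. Math. 10 (2008), §2.1.
-/

noncomputable section

set_option linter.dupNamespace false

open Module CategoryTheory MonoidalCategory CartesianMonoidalCategory
open Literature.AlgebraicTopology.SingularHomology
open Literature.AlgebraicGeometry Literature.AlgebraicGeometry.Motives Literature.AlgebraicGeometry.HodgeTheory
open Literature.AlgebraicGeometry.Hyperkaehler

namespace Summit.HodgeConjecture.HodgeConjecture.Theorems.MarkmanPartnerTransport.PartnerLattice

/-- `MarkedK3Sq[X, φ, P, z]`: VERBATIM the `let MarkedK3Sq := …` binder of the route declarations of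
MarkmanPartnerTransport (clauses (m1)–(m6)), as in `…IsometrySpannedThirdKappaClasses`. Local notation only. -/
local notation3 (prettyPrint := false) "MarkedK3Sq[" X ", " φ ", " P ", " z "]" =>
  (((IsIntegralClass P ∧ ∀ Q : complexBetti X (2 * 4), IsIntegralClass Q → ∃ n : ℤ, Q = n • P) ∧
    (∀ c : complexBetti X 2, IsIntegralClass c ↔ ∃ v : K3HilbertIndex → ℤ, φ c = fun i => (v i : ℂ)) ∧
    (∀ a : complexBetti X 2, cupPowTwo a 4 = ((3 : ℂ) * (k3HilbertForm 2 (φ a) (φ a)) ^ 2) • P) ∧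
    (IsOfHodgeType 4 X 2 2 0 (LinearEquiv.symm φ z) ∧
      ∀ τ : complexBetti X 2, IsOfHodgeType 4 X 2 2 0 τ → ∃ t : ℂ, τ = t • LinearEquiv.symm φ z) ∧
    (∀ c : complexBetti X 2, IsOfHodgeType 4 X 2 1 1 c ↔
      (k3HilbertForm 2 (φ c) z = 0 ∧ k3HilbertForm 2 (φ c) (star z) = 0)) ∧
    (k3HilbertForm 2 z z = 0 ∧ 0 < (k3HilbertForm 2 (star z) z).re)))

/-- `Kappa[X, φ]`: VERBATIM the hypothesis shape of `isometrySpannedThird_of_kappaClasses`: for every bijective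
rational Hodge `q`-isometry `g` of `H²(X)` the class `κ_g = Σ_{ij} (G⁻¹)_{ij} · φ⁻¹eᵢ ∪ g(φ⁻¹eⱼ)` is algebraic.
Local notation only. -/
local notation3 (prettyPrint := false) "Kappa[" X ", " φ "]" =>
  ∀ g : complexBetti X 2 →ₗ[ℂ] complexBetti X 2, Function.Bijective g →
    (∀ y, IsRationalClass y → IsRationalClass (g y)) →
    (∀ (a b : ℕ) y, IsOfHodgeType 4 X 2 a b y → IsOfHodgeType 4 X 2 a b (g y)) →
    (∀ a b, k3HilbertForm 2 (φ (g a)) (φ (g b)) = k3HilbertForm 2 (φ a) (φ b)) →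
    (∑ i : K3HilbertIndex, ∑ j : K3HilbertIndex,
      (((k3HilbertGram 2).map (Int.cast : ℤ → ℂ))⁻¹ i j) •
        cupProduct (rfl : 2 + 2 = 2 * 2) ((LinearEquiv.symm φ) (Pi.single i 1))
          (g ((LinearEquiv.symm φ) (Pi.single j 1)))) ∈ algebraicClasses X 2

variable {X : SchemeOver ℂ}

/-- **The inverse Beauville–Bogomolov class `Q_X = q⁻¹ ∈ H⁴((X ⊗ X)(ℂ); ℂ)`** of a marking
`φ : H²(X(ℂ); ℂ) ≃ Λ_ℂ`: `Σᵢⱼ (G⁻¹)ᵢⱼ · pr₁^*(φ⁻¹eᵢ) ∪ pr₂^*(φ⁻¹eⱼ)`, with `G = k3HilbertGram 2` the Gram matrix of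
`q = k3HilbertForm 2` in the standard basis `eᵢ` of `ℂ²³` (the tensor `q⁻¹ ∈ H²(X) ⊗ H²(X)` placed in
`H⁴(X × X)` by the Künneth cup product; O'Grady's dual class `q^∨` is its pull-back along the diagonal). -/
def qInvClass (φ : complexBetti X 2 ≃ₗ[ℂ] (K3HilbertIndex → ℂ)) : complexBetti (X ⊗ X) (2 * 2) :=
  ∑ i : K3HilbertIndex, ∑ j : K3HilbertIndex,
    (((k3HilbertGram 2).map (Int.cast : ℤ → ℂ))⁻¹ i j) • cupProduct (rfl : 2 + 2 = 2 * 2)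
      (complexBetti.map (fst X X) 2 (φ.symm (Pi.single i 1)))
      (complexBetti.map (snd X X) 2 (φ.symm (Pi.single j 1)))

/-- **F-QX (a statement, consumed below as a hypothesis): for every marked smooth projective `K3^{[2]}`-type
fourfold `X`, the inverse Beauville–Bogomolov class `Q_X` is algebraic on `X ⊗ X` in codimension `2`.**
Expected from the Lefschetz standard conjecture in degree `2` for `K3^{[2]}`-type (Charles–Markman 2013: Kleiman's
`θ = (L_h²)⁻¹` is algebraic; its Künneth `(2,2)`-part is the inverse tensor of `⟨a,b⟩_h = ∫ a b h²`; polarised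
Fujiki and Sherman–Morrison express `Q_X` through it) — that derivation is the separate target W-QX2 and is NOT
asserted here. -/
def QInvAlgebraic : Prop :=
  ∀ (X : SchemeOver ℂ), IsSmoothProjective 4 X → IsOfK3HilbertSquareType X →
    ∀ (φ : complexBetti X 2 ≃ₗ[ℂ] (K3HilbertIndex → ℂ)) (P : complexBetti X (2 * 4)) (z : K3HilbertIndex → ℂ),
      MarkedK3Sq[X, φ, P, z] → qInvClass φ ∈ algebraicClasses (X ⊗ X) 2

/-- **`κ_g = pr_{1*}(Q_X ∪ Z)` — the projection-formula identity.** For a smooth projective fourfold `X`, a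
marking `φ`, an orientation family `μ` with Poincaré duality, a class `Z ∈ H⁸((X ⊗ X)(ℂ); ℂ)` and a linear `g`
with `g = [Z]_* = pr_{1*}(pr₂^*(–) ∪ Z)` (`corrAction μ`), the kappa class
`Σᵢⱼ (G⁻¹)ᵢⱼ · φ⁻¹eᵢ ∪ g(φ⁻¹eⱼ)` equals `pr_{1*}(Q_X ∪ Z)`: each summand is `a ∪ pr_{1*}(pr₂^* b ∪ Z) =
pr_{1*}(pr₁^* a ∪ (pr₂^* b ∪ Z)) = pr_{1*}((pr₁^* a ∪ pr₂^* b) ∪ Z)` (projection formula `complexGysin_cup`,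
associativity `cupProduct_assoc`), and `pr_{1*}(– ∪ Z)` is linear.
[cite: FultonYoungTableaux1997, Appendix B §B.1 (6)] [cite: VoisinHodgeII2003, proof of Thm. 10.17 (10.7)] -/
theorem kappaClass_eq_complexGysin_qInvClass_cup {μ : OrientationFamily} (hμ : μ.HasPoincareDuality)
    (hX : IsSmoothProjective 4 X) (φ : complexBetti X 2 ≃ₗ[ℂ] (K3HilbertIndex → ℂ))
    (Z : complexBetti (X ⊗ X) (2 * 4)) (g : complexBetti X 2 →ₗ[ℂ] complexBetti X 2)
    (hg : ∀ x : complexBetti X 2, g x = corrAction μ hX hX (rfl : 2 + 2 * 4 = 2 + 2 * 4) Z x) :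
    (∑ i : K3HilbertIndex, ∑ j : K3HilbertIndex,
      (((k3HilbertGram 2).map (Int.cast : ℤ → ℂ))⁻¹ i j) •
        cupProduct (rfl : 2 + 2 = 2 * 2) ((LinearEquiv.symm φ) (Pi.single i 1))
          (g ((LinearEquiv.symm φ) (Pi.single j 1)))) =
      complexGysin μ (IsSmoothProjective.tensor_holds hX hX) hX (fst X X)
        (show 2 * (2 + 4) + 2 * 4 = 2 * 2 + 2 * (4 + 4) by norm_num)
        (cupProduct (two_mul_add_two_mul 2 4) (qInvClass φ) Z) := by
  classical
  -- the linear map `q ↦ pr_{1*}(q ∪ Z)` on `H⁴((X ⊗ X)(ℂ))`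
  set L : complexBetti (X ⊗ X) (2 * 2) →ₗ[ℂ] complexBetti X (2 * 2) :=
    complexGysin μ (IsSmoothProjective.tensor_holds hX hX) hX (fst X X)
        (show 2 * (2 + 4) + 2 * 4 = 2 * 2 + 2 * (4 + 4) by norm_num) ∘ₗ
      (cupProduct (two_mul_add_two_mul 2 4)).flip Z with hL
  have hLapply : ∀ q : complexBetti (X ⊗ X) (2 * 2),
      L q = complexGysin μ (IsSmoothProjective.tensor_holds hX hX) hX (fst X X)
        (show 2 * (2 + 4) + 2 * 4 = 2 * 2 + 2 * (4 + 4) by norm_num)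
        (cupProduct (two_mul_add_two_mul 2 4) q Z) := fun q => rfl
  -- each summand: `a ∪ g b = pr_{1*}((pr₁^* a ∪ pr₂^* b) ∪ Z)`
  have key : ∀ a b : complexBetti X 2,
      cupProduct (rfl : 2 + 2 = 2 * 2) a (g b) =
        L (cupProduct (rfl : 2 + 2 = 2 * 2) (complexBetti.map (fst X X) 2 a)
          (complexBetti.map (snd X X) 2 b)) := by
    intro a b
    rw [hLapply, hg b, corrAction_apply,
      cupProduct_assoc (rfl : 2 + 2 = 2 * 2) (rfl : 2 + 2 * 4 = 2 + 2 * 4) (two_mul_add_two_mul 2 4)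
        (show 2 + (2 + 2 * 4) = 2 * (2 + 4) by norm_num),
      complexGysin_cup hμ (IsSmoothProjective.tensor_holds hX hX) hX (fst X X)
        (show 2 + (2 + 2 * 4) = 2 * (2 + 4) by norm_num)
        (show 2 * (2 + 4) + 2 * 4 = 2 * 2 + 2 * (4 + 4) by norm_num)
        (corrAction_degree (n := 4) (e := 4) (a := 2) (b := 2) 4 rfl)
        (rfl : 2 + 2 = 2 * 2)]
  rw [← hLapply, qInvClass, map_sum]
  refine Finset.sum_congr rfl fun i _ => ?_
  rw [map_sum]
  refine Finset.sum_congr rfl fun j _ => ?_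
  rw [map_smul, key]

/-- **W-QX1 — the kappa classes are algebraic, granted `QInvAlgebraic`, Markman's theorem (marked form) and the
multiplicativity of algebraic classes.** For every marked smooth projective `K3^{[2]}`-type `X` and every bijective
rational Hodge `q`-isometry `g` of `H²(X)`: Markman gives an algebraic `Z_g ∈ A⁴(X ⊗ X)` with `g = [Z_g]_*`
(same marking on both sides, `f = g`); then `κ_g = pr_{1*}(Q_X ∪ Z_g)`
(`kappaClass_eq_complexGysin_qInvClass_cup`), `Q_X ∪ Z_g ∈ A⁶(X ⊗ X)` (`Voisin2003_cupProduct_algebraicClasses`),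
and the Gysin push-forward of an algebraic class is algebraic (`complexGysin_mem_supportedClasses`). The
conclusion is VERBATIM the hypothesis `hκ` of `isometrySpannedThird_of_kappaClasses`. CONDITIONAL; credits nothing.
[cite: Markman2024, Thm. 1.1 (§1.1)] [cite: VoisinHodgeII2003, §9.2.4 Prop. 9.20 and proof of Thm. 10.17 (10.7)] -/
theorem kappaClasses_of_qInvAlgebraic (hQ : QInvAlgebraic) (hMk : Markman2024_rationalHodgeIsometry_algebraic_marked)
    (hcup : Voisin2003_cupProduct_algebraicClasses) :
    ∀ (X : SchemeOver ℂ), IsSmoothProjective 4 X → IsOfK3HilbertSquareType X →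
      ∀ (φ : complexBetti X 2 ≃ₗ[ℂ] (K3HilbertIndex → ℂ)) (P : complexBetti X (2 * 4)) (z : K3HilbertIndex → ℂ),
      MarkedK3Sq[X, φ, P, z] → Kappa[X, φ] := by
  intro X hX hK φ P z hM g hbij hrat hh hiso
  classical
  -- an orientation family (any) and its Poincaré duality
  let μ : OrientationFamily := fun _ _ h ↦ Classical.choice (Motives.ComplexPoints.isOrientableOver ℂ h)
  have hμ : μ.HasPoincareDuality := OrientationFamily.hasPoincareDuality μ
  -- Markman: `g = [Z]_*` with `Z` algebraic on `X ⊗ X`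
  obtain ⟨Z, hZ, hgZ⟩ := hMk μ hμ X X hX hX hK hK φ P z φ P z hM hM g hbij hrat hh hiso
  -- `κ_g = pr_{1*}(Q_X ∪ Z)`
  rw [kappaClass_eq_complexGysin_qInvClass_cup hμ hX φ Z g hgZ]
  -- `Q_X ∪ Z` is algebraic on the eightfold `X ⊗ X`, and so is its Gysin image
  have hXX : IsSmoothProjective (4 + 4) (X ⊗ X) := IsSmoothProjective.tensor_holds hX hX
  have hQZ : cupProduct (two_mul_add_two_mul 2 4) (qInvClass φ) Z ∈ algebraicClasses (X ⊗ X) (2 + 4) :=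
    hcup hXX (hQ X hX hK φ P z hM) hZ
  exact complexGysin_mem_supportedClasses (gysinMap_restrictCompl_eq_zero_of_field ℂ) μ hμ
    (IsSmoothProjective.tensor_holds hX hX) hX (fst X X) _ (r := 2 + 4) (s := 2) (by norm_num) hQZ

/-- **`IsometrySpannedThird` BY NAME, every Picard rank, from four published facts and the hypothesis
`QInvAlgebraic`** — the composition of `kappaClasses_of_qInvAlgebraic` with `isometrySpannedThird_of_kappaClasses`.
CONDITIONAL (on `QInvAlgebraic`, target W-QX2, and on the named facts); credits nothing; rung F-H1 not moved.
[cite: Markman2024, Thm. 1.1 (§1.1)] [cite: OGrady2008NumericalK3Square, §2.1 (2.1.2)] -/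
theorem isometrySpannedThird_of_qInvAlgebraic
    (hV : VerbitskyGuan_cohomology_K3HilbertSquareType) (hO : OGrady2008_dualBBFClass_algebraic)
    (hcup : Voisin2003_cupProduct_algebraicClasses) (hMk : Markman2024_rationalHodgeIsometry_algebraic_marked)
    (hQ : QInvAlgebraic) :
    Summit.HodgeConjecture.HodgeConjecture.Theses.MarkmanPartnerTransport.IsometrySpannedThird :=
  isometrySpannedThird_of_kappaClasses hV hO hcup (kappaClasses_of_qInvAlgebraic hQ hMk hcup)

end Summit.HodgeConjecture.HodgeConjecture.Theorems.MarkmanPartnerTransport.PartnerLattice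

end
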